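import Summits.BirchSwinnertonDyer.Rank1Residual.Additive.KatoDescentKummerUnramifiedCountDischarged
import Summits.BirchSwinnertonDyer.Rank1Residual.Additive.KatoDescentKummerUnramifiedLocalIndex
import HarnessLib

set_option autoImplicit false

/-!
# (R1-d) AT FINITE LEVEL, ASSEMBLED: for `k ≫ 0`, `[H¹_{𝓚 ⊔ ur@Σ}(K, E[p^k]) : H¹_{𝓚 ⊓ ur@Σ}(K, E[p^k])] = ∏_{v∈Σ} p^{v_p(c_v)}`
# over every number field `K : Type`, `p` odd, `Σ` a finite set of ADDITIVE places `v ∤ p` — the Tamagawa constant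
# `C′ = ∏_{v∈Σ} c_v^{(p)}` of Kato's (14.9.3) / the potss memo's (R1-d), unconditionally
# (seat `bsd-cm-prr-ty1` g11, cell `bsd-cm`; theorems only: no definition, no named fact, no instance, no `sorry`)

Part 25 of the seat's kernel cut of stub 3 `stub_rankOneCountReadingKato` of the Kato–Perrin-Riou skeletons v4 (cruxes
stmt-BirchSwinnertonDyer-19945 / -19223; = cell bsd-potss's held input 27322).  Assembly of Part 23
(`KatoDescentKummerUnramifiedCountDischarged`: `[H¹_𝓖 : H¹_{𝓖'}] = ∏_{v∈Σ} [𝓚_v ⊔ H¹_ur(K_v, E[p^k]) : 𝓚_v]` for every `k ≥ 1`,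
Poitou–Tate and Weil data discharged) with Part 24 (`KatoDescentKummerUnramifiedLocalIndex`:
`∃ k₀, ∀ k ≥ k₀, ∏_{v∈Σ} [𝓚_v ⊔ H¹_ur : 𝓚_v] = ∏_{v∈Σ} p^{v_p(c_v)}` at additive `v ∤ p`):

* **`exists_forall_le_relIndex_selmerGroup_eq_prod_pow_padicValNat_localTamagawaNumber`** — for an elliptic curve over a
  number field `K : Type`, an odd prime `p`, finite sets `Σ ⊆ T` of finite places with every `v ∈ Σ` ADDITIVE and `∤ p`,
  `T ⊇ {v ∣ p} ∪ {bad places}`: **`∃ k₀ ≥ 1, ∀ k ≥ k₀`, for ALL Selmer structures `𝓖`, `𝓖'` on `E[p^k]` of the shape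
  «`𝓚_v ⊔ H¹_ur` resp. `𝓚_v ⊓ H¹_ur` at `v ∈ Σ`, `𝓚_v` at the other finite places, `𝓖'_w ≤ 𝓖_w` at `∞`»:
  `H¹_{𝓖'} ≤ H¹_𝓖` and `[H¹_𝓖(K, E[p^k]) : H¹_{𝓖'}(K, E[p^k])] = ∏_{v∈Σ} p^{v_p(c_v)}`** (`c_v` = the local Tamagawa number of
  `E ⊗ K_v`), and `…_eq_pow_sum` — the same as `p ^ (∑_{v∈Σ} v_p(c_v))`.

On the rows of stub 3 (`W/ℚ` with complex multiplication, hence additive at every bad prime; `p` an odd bad prime; `Σ` = the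
bad primes `≠ p`, `T = Σ ∪ {p}`) this is the level-`p^k` form of (R1-d) with its right-hand side EVALUATED:
`[H¹_{𝓚⊔ur@Σ}(ℚ, W[p^k]) : H¹_{𝓚⊓ur@Σ}(ℚ, W[p^k])] = p^{∑_{ℓ≠p} v_p(c_ℓ)}` for all large `k`.  REMAINING inside (R1-d): the
passage `k → ∞` (discrete side `H¹_{𝓚⊔ur@Σ} ≅ S(T)[p^k]`, `Sel^{(p^k)} ≅ Sel_{p^∞}[p^k]`; compact side `[Sel^{(p^k)} : H¹_{𝓚⊓ur@Σ}]
→ p^a`), Parts 26+.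

HONEST LABEL: theorems only; no stub or item is closed; nothing is registered; nothing is asserted on 19945 / 19223;
Kato's Main Conjecture and Perrin-Riou's conjecture are not touched; BSD is not proved for any curve.

References: [Rubin2000] Thm. 1.7.3; [Kato2004Asterisque] §14.8 (p. 238), (14.9.3) (p. 240); [MilneADT2006] Ch. I Thm. 4.10,
Lemma 2.9; [GreenbergLNM1716] §4 (p. 74); [SilvermanAEC2009] Thm. VII.6.1.
-/

noncomputable section

open scoped Classical ContRepresentation NumberField
open Function Field NumberField IsDedekindDomain WeierstrassCurve
open Literature.NumberTheory.EllipticCurves Literature.NumberTheory.GaloisRepresentations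
  Literature.NumberTheory.GaloisRepresentations.DiscreteGaloisModule Literature.NumberTheory.GaloisCohomology

namespace Summit.BirchSwinnertonDyer.Rank1Residual.Additive.KummerUnramified

variable {K : Type} [Field K] [NumberField K] (W : WeierstrassCurve K) [W.IsElliptic] (p : ℕ) [hp : Fact p.Prime]

/-- **(R1-d) at finite level, assembled and evaluated**: `∃ k₀ ≥ 1, ∀ k ≥ k₀`, for all `𝓖`, `𝓖'` of the shape «Kummer ⊔ unramified
resp. Kummer ⊓ unramified at `Σ`, Kummer at the other finite places», `H¹_{𝓖'}(K, E[p^k]) ≤ H¹_𝓖(K, E[p^k])` and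
`[H¹_𝓖 : H¹_{𝓖'}] = ∏_{v∈Σ} p^{v_p(c_v)}` — `p` odd, `Σ ⊆ T` finite, every `v ∈ Σ` additive with `v ∤ p`,
`T ⊇ {v ∣ p} ∪ {bad}`. [cite: Rubin2000, Thm. 1.7.3] [cite: Kato2004Asterisque, §14.8 (p. 238) and (14.9.3) (p. 240)]
[cite: MilneADT2006, Ch. I, Thm. 4.10] [cite: SilvermanAEC2009, Thm. VII.6.1] -/
theorem exists_forall_le_relIndex_selmerGroup_eq_prod_pow_padicValNat_localTamagawaNumber (hodd : p ≠ 2)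
    (Q T : Finset (HeightOneSpectrum (𝓞 K))) (hQT : Q ⊆ T)
    (hQp : ∀ v ∈ Q, ((p : ℕ) : 𝓞 K) ∉ v.asIdeal) (hQadd : ∀ v ∈ Q, W.HasAdditiveReductionAt v)
    (hTp : ∀ v : HeightOneSpectrum (𝓞 K), ((p : ℕ) : 𝓞 K) ∈ v.asIdeal → v ∈ T)
    (hTbad : ∀ v : HeightOneSpectrum (𝓞 K), ¬ W.HasGoodReductionAt v → v ∈ T) :
    ∃ k₀ : ℕ, 1 ≤ k₀ ∧ ∀ k, k₀ ≤ k →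
      ∀ (𝓖 𝓖' : SelmerStructure (W.torsionGaloisModule ((p ^ k : ℕ) : ℤ))),
        (∀ v ∈ Q, 𝓖 (Sum.inr v) = W.kummerSelmerStructure ((p ^ k : ℕ) : ℤ) (Sum.inr v) ⊔
          unramifiedSubgroup (GaloisRep.toLocal v (W.torsionGaloisModule ((p ^ k : ℕ) : ℤ))) 1) →
        (∀ v ∉ Q, 𝓖 (Sum.inr v) = W.kummerSelmerStructure ((p ^ k : ℕ) : ℤ) (Sum.inr v)) →
        (∀ v ∈ Q, 𝓖' (Sum.inr v) = W.kummerSelmerStructure ((p ^ k : ℕ) : ℤ) (Sum.inr v) ⊓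
          unramifiedSubgroup (GaloisRep.toLocal v (W.torsionGaloisModule ((p ^ k : ℕ) : ℤ))) 1) →
        (∀ v ∉ Q, 𝓖' (Sum.inr v) = W.kummerSelmerStructure ((p ^ k : ℕ) : ℤ) (Sum.inr v)) →
        (∀ w : InfinitePlace K, 𝓖' (Sum.inl w) ≤ 𝓖 (Sum.inl w)) →
        𝓖'.selmerGroup ≤ 𝓖.selmerGroup ∧
          𝓖'.selmerGroup.relIndex 𝓖.selmerGroup =
            ∏ v ∈ Q, p ^ padicValNat p
              ((W.baseChange (v.adicCompletion K)).localTamagawaNumber (v.adicCompletionIntegers K)) := by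
  obtain ⟨k₁, hk₁⟩ := exists_forall_le_prod_relIndex_kummer_sup_unramified_eq W p hodd Q hQp hQadd
  refine ⟨max 1 k₁, le_max_left _ _, fun k hk 𝓖 𝓖' h𝓖Q h𝓖nQ h𝓖'Q h𝓖'nQ h𝓖'inl => ?_⟩
  obtain ⟨hle, hidx⟩ := relIndex_selmerGroup_kummerInfUnramified_eq_of_prime_pow W p k hodd
    (le_trans (le_max_left _ _) hk) Q T hQT hQp hTp hTbad 𝓖 𝓖' h𝓖Q h𝓖nQ h𝓖'Q h𝓖'nQ h𝓖'inl
  exact ⟨hle, hidx.trans (hk₁ k (le_trans (le_max_right _ _) hk))⟩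

/-- The same with the right-hand side as ONE power of `p`: `[H¹_𝓖 : H¹_{𝓖'}] = p ^ (∑_{v∈Σ} v_p(c_v))` for `k ≫ 0`.
[cite: Rubin2000, Thm. 1.7.3] [cite: Kato2004Asterisque, (14.9.3) (p. 240)] -/
theorem exists_forall_le_relIndex_selmerGroup_eq_pow_sum_padicValNat_localTamagawaNumber (hodd : p ≠ 2)
    (Q T : Finset (HeightOneSpectrum (𝓞 K))) (hQT : Q ⊆ T)
    (hQp : ∀ v ∈ Q, ((p : ℕ) : 𝓞 K) ∉ v.asIdeal) (hQadd : ∀ v ∈ Q, W.HasAdditiveReductionAt v)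
    (hTp : ∀ v : HeightOneSpectrum (𝓞 K), ((p : ℕ) : 𝓞 K) ∈ v.asIdeal → v ∈ T)
    (hTbad : ∀ v : HeightOneSpectrum (𝓞 K), ¬ W.HasGoodReductionAt v → v ∈ T) :
    ∃ k₀ : ℕ, 1 ≤ k₀ ∧ ∀ k, k₀ ≤ k →
      ∀ (𝓖 𝓖' : SelmerStructure (W.torsionGaloisModule ((p ^ k : ℕ) : ℤ))),
        (∀ v ∈ Q, 𝓖 (Sum.inr v) = W.kummerSelmerStructure ((p ^ k : ℕ) : ℤ) (Sum.inr v) ⊔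
          unramifiedSubgroup (GaloisRep.toLocal v (W.torsionGaloisModule ((p ^ k : ℕ) : ℤ))) 1) →
        (∀ v ∉ Q, 𝓖 (Sum.inr v) = W.kummerSelmerStructure ((p ^ k : ℕ) : ℤ) (Sum.inr v)) →
        (∀ v ∈ Q, 𝓖' (Sum.inr v) = W.kummerSelmerStructure ((p ^ k : ℕ) : ℤ) (Sum.inr v) ⊓
          unramifiedSubgroup (GaloisRep.toLocal v (W.torsionGaloisModule ((p ^ k : ℕ) : ℤ))) 1) →
        (∀ v ∉ Q, 𝓖' (Sum.inr v) = W.kummerSelmerStructure ((p ^ k : ℕ) : ℤ) (Sum.inr v)) →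
        (∀ w : InfinitePlace K, 𝓖' (Sum.inl w) ≤ 𝓖 (Sum.inl w)) →
        𝓖'.selmerGroup ≤ 𝓖.selmerGroup ∧
          𝓖'.selmerGroup.relIndex 𝓖.selmerGroup =
            p ^ ∑ v ∈ Q, padicValNat p
              ((W.baseChange (v.adicCompletion K)).localTamagawaNumber (v.adicCompletionIntegers K)) := by
  obtain ⟨k₀, hk₀, h⟩ := exists_forall_le_relIndex_selmerGroup_eq_prod_pow_padicValNat_localTamagawaNumber W p hodd Q T
    hQT hQp hQadd hTp hTbad
  refine ⟨k₀, hk₀, fun k hk 𝓖 𝓖' h𝓖Q h𝓖nQ h𝓖'Q h𝓖'nQ h𝓖'inl => ?_⟩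
  obtain ⟨hle, hidx⟩ := h k hk 𝓖 𝓖' h𝓖Q h𝓖nQ h𝓖'Q h𝓖'nQ h𝓖'inl
  exact ⟨hle, hidx.trans (Finset.prod_pow_eq_pow_sum _ _ _)⟩

end Summit.BirchSwinnertonDyer.Rank1Residual.Additive.KummerUnramified

end
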